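import Mathlib
import Summits.Ventures.PercRepro2.TriDisagreementPinned
import Summits.Ventures.PercRepro2.HullPieceFlip
import Summits.Ventures.PercRepro2.CrossAPrimeCubic

/-!
# A three-copy switching: the typed form of `P(Q,vL,oH)·P(Q,bH) ≤ P(vL)·P(Q,oH)·P(Q,bH)`
(blind cell PercRepro2, p5 g32; `proofs/P5-OEDGE.md` §42 (3), S4 §2.4 (s) addendum 18 (c))

For three copies `(x, y, w)` of the configuration space let `K_N x y w = 1_{Q,vL,oH}(x)·1_{Q,bH}(y)`
and `K_P x y w = 1_{Q,oH}(x)·1_{Q,bH}(y)·1_{vL}(w)` — the negative term `N₁` and the positive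
triple-product term `P₂` of the kernel `K_{A′}` of `crossA′so` (`CrossAPrimeCubic.KAprime`).
**`typedCount_N_le_P`**: for every minor `(F, z)` and every type map `τ`, the typed three-copy count
of `K_N` is at most that of `K_P`.  PROOF (`sw`): explore the cluster `K = C_x(a₂)` of the root in
the first copy and EXCHANGE the first and third copies on every edge NOT touching `K`.  The column
multiset of every edge is preserved (`openCount_sw`, `agree_sw`), so the typed fibre is mapped to
itself; the first copy keeps `K` as its `a₂`-cluster (domain Markov, `cluster_eq_of_eqOn_touches`),
so `Q` and `o ∈ C(a₂)` survive; the path `a₁ → v` of the first copy never meets `K`, so it moves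
intact into the third copy (`Hull.conn_of_eqOn_off_touches`); the map is an involution
(`sw_sw`), hence injective.  Weighted consequence: `P(Q,vL,oH)·P(Q,bH) ≤ P(a₁ ↔ v)·P(Q,oH)·P(Q,bH)`
for every weight vector (BHK06 1.4 + Harris) — here obtained as a WEIGHT-FREE typed statement by
a column-permuting injection, the first three-copy switching in the cell's kernel.  Own work;
standard axioms.
-/

namespace Summit.Ventures.PercRepro2

open CovForm CrossAPrimeCubic

namespace ThreeCopySwitch

section Switch

variable {V : Type*} {E : Type*} [Fintype E] [DecidableEq E]

open Classical in
/-- **The switching**: exchange the first and the third copy on the edges NOT touching the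
`a₂`-cluster of the first copy; the second copy is untouched. -/
noncomputable def sw (ends : E → Sym2 V) (a₂ : V) (t : Config E × Config E × Config E) :
    Config E × Config E × Config E :=
  (fun e => if e ∈ touches ends (cluster ends t.1 a₂) then t.1 e else t.2.2 e, t.2.1,
    fun e => if e ∈ touches ends (cluster ends t.1 a₂) then t.2.2 e else t.1 e)

omit [Fintype E] [DecidableEq E] in
/-- The first copy keeps its `a₂`-cluster. -/
lemma cluster_sw_fst (ends : E → Sym2 V) (a₂ : V) (t : Config E × Config E × Config E) :
    cluster ends (sw ends a₂ t).1 a₂ = cluster ends t.1 a₂ := by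
  classical
  refine cluster_eq_of_eqOn_touches (ω := t.1) (fun e he => ?_) rfl
  simp only [sw, if_pos he]

omit [Fintype E] [DecidableEq E] in
/-- The switching is an involution. -/
lemma sw_sw (ends : E → Sym2 V) (a₂ : V) (t : Config E × Config E × Config E) :
    sw ends a₂ (sw ends a₂ t) = t := by
  classical
  have hK := cluster_sw_fst ends a₂ t
  obtain ⟨x, y, w⟩ := t
  simp only [sw] at hK ⊢
  rw [hK]
  refine Prod.ext ?_ (Prod.ext rfl ?_)
  · funext e; by_cases he : e ∈ touches ends (cluster ends x a₂) <;> simp [he]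
  · funext e; by_cases he : e ∈ touches ends (cluster ends x a₂) <;> simp [he]

omit [Fintype E] [DecidableEq E] in
/-- An `a₁ → v` connection of the first copy with `a₁ ∉ C_x(a₂)` moves intact into the third
copy. -/
lemma conn_sw_thd (ends : E → Sym2 V) {a₁ a₂ v : V} (t : Config E × Config E × Config E)
    (h1 : a₁ ∉ cluster ends t.1 a₂) (hc : Conn ends t.1 a₁ v) :
    Conn ends (sw ends a₂ t).2.2 a₁ v := by
  classical
  refine Hull.conn_of_eqOn_off_touches (l := a₂) (P := cluster ends t.1 a₂) (ω := t.1)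
    le_rfl h1 (fun e he => ?_) hc
  simp only [sw, if_neg he]

omit [Fintype E] [DecidableEq E] in
/-- The column multiset of every edge is preserved. -/
lemma openCount_sw (ends : E → Sym2 V) (a₂ : V) (t : Config E × Config E × Config E) (e : E) :
    openCount (sw ends a₂ t).1 (sw ends a₂ t).2.1 (sw ends a₂ t).2.2 e =
      openCount t.1 t.2.1 t.2.2 e := by
  classical
  simp only [sw, openCount]
  by_cases he : e ∈ touches ends (cluster ends t.1 a₂)
  · simp [he]
  · simp only [he, if_false]
    omega

omit [Fintype E] [DecidableEq E] in
/-- Agreement with a pinned configuration off `F` is preserved. -/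
lemma agree_sw (ends : E → Sym2 V) (a₂ : V) (t : Config E × Config E × Config E) (z : Config E)
    (F : Finset E) (h : ∀ e, e ∉ F → t.1 e = z e ∧ t.2.1 e = z e ∧ t.2.2 e = z e) :
    ∀ e, e ∉ F → (sw ends a₂ t).1 e = z e ∧ (sw ends a₂ t).2.1 e = z e ∧
      (sw ends a₂ t).2.2 e = z e := by
  classical
  intro e he
  obtain ⟨h1, h2, h3⟩ := h e he
  simp only [sw]
  by_cases hK : e ∈ touches ends (cluster ends t.1 a₂) <;> simp [hK, h1, h2, h3]

/-- The switching as a permutation of the triples. -/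
noncomputable def swPerm (ends : E → Sym2 V) (a₂ : V) :
    Equiv.Perm (Config E × Config E × Config E) :=
  Function.Involutive.toPerm (sw ends a₂) (sw_sw ends a₂)

end Switch

section Kernels

variable {V : Type*} {E : Type*} [Fintype E] [DecidableEq E] {R : Type*} [Field R]

/-- `K_N x y w = 1_{Q,vL,oH}(x)·1_{Q,bH}(y)` — the negative term `N₁` of `K_{A′}`. -/
noncomputable def KN (ends : E → Sym2 V) (o a₁ a₂ v b : V) :
    Config E → Config E → Config E → R :=
  fun x y _ => iQLH ends a₁ a₂ v o x * iQH ends a₁ a₂ b y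

/-- `K_P x y w = 1_{Q,oH}(x)·1_{Q,bH}(y)·1_{vL}(w)` — the triple-product term `P₂` of `K_{A′}`. -/
noncomputable def KP (ends : E → Sym2 V) (o a₁ a₂ v b : V) :
    Config E → Config E → Config E → R :=
  fun x y w => iQH ends a₁ a₂ o x * iQH ends a₁ a₂ b y * iL ends a₁ v w

end Kernels

section Main

variable {V : Type*} {E : Type*} [Fintype E] [DecidableEq E] {R : Type*} [Field R]
  [LinearOrder R] [IsStrictOrderedRing R]

/-- The typed predicate of `typedCount`. -/
abbrev Typed (F : Finset E) (z : Config E) (τ : E → ℕ) (t : Config E × Config E × Config E) : Prop :=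
  (∀ e, e ∉ F → t.1 e = z e ∧ t.2.1 e = z e ∧ t.2.2 e = z e) ∧
    (∀ e ∈ F, openCount t.1 t.2.1 t.2.2 e = τ e)

omit [Fintype E] [DecidableEq E] in
/-- The switching preserves the typed predicate. -/
lemma typed_sw (ends : E → Sym2 V) (a₂ : V) {F : Finset E} {z : Config E} {τ : E → ℕ}
    {t : Config E × Config E × Config E} (h : Typed F z τ t) : Typed F z τ (sw ends a₂ t) :=
  ⟨agree_sw ends a₂ t z F h.1, fun e he => by rw [openCount_sw]; exact h.2 e he⟩

/-- The pointwise domination: a typed triple in the support of `K_N` is sent by `sw` to a typed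
triple in the support of `K_P`. -/
lemma pointwise (ends : E → Sym2 V) (o a₁ a₂ v b : V) (F : Finset E) (z : Config E) (τ : E → ℕ)
    (t : Config E × Config E × Config E) :
    (if Typed F z τ t then KN (R := R) ends o a₁ a₂ v b t.1 t.2.1 t.2.2 else 0) ≤
      (if Typed F z τ (sw ends a₂ t) then
        KP (R := R) ends o a₁ a₂ v b (sw ends a₂ t).1 (sw ends a₂ t).2.1 (sw ends a₂ t).2.2 else 0) := by
  classical
  by_cases hT : Typed F z τ t
  · rw [if_pos hT, if_pos (typed_sw ends a₂ hT)]
    unfold KN KP iQLH iQH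
    by_cases hx : t.1 ∈ avoidAll ends a₂ {a₁} ∩ (connEvent ends a₁ v ∩ connEvent ends a₂ o)
    · by_cases hy : t.2.1 ∈ avoidAll ends a₂ {a₁} ∩ connEvent ends a₂ b
      · rw [Set.indicator_of_mem hx, Set.indicator_of_mem hy]
        -- the facts in the first copy
        have hQ : a₁ ∉ cluster ends t.1 a₂ := by
          have := hx.1
          rw [mem_avoidAll] at this
          exact fun h => this a₁ (Finset.mem_singleton_self a₁) (mem_cluster.1 h)
        have hvL : Conn ends t.1 a₁ v := hx.2.1
        have hoH : Conn ends t.1 a₂ o := hx.2.2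
        have hK := cluster_sw_fst ends a₂ t
        have hx' : (sw ends a₂ t).1 ∈ avoidAll ends a₂ {a₁} ∩ connEvent ends a₂ o := by
          refine ⟨?_, ?_⟩
          · rw [mem_avoidAll]
            intro x hxs hc
            rw [Finset.mem_singleton] at hxs
            subst hxs
            exact hQ (hK ▸ mem_cluster.2 hc)
          · exact mem_cluster.1 (hK ▸ mem_cluster.2 hoH)
        have hw' : (sw ends a₂ t).2.2 ∈ connEvent ends a₁ v := conn_sw_thd ends t hQ hvL
        have hy' : (sw ends a₂ t).2.1 ∈ avoidAll ends a₂ {a₁} ∩ connEvent ends a₂ b := hy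
        unfold iL
        rw [Set.indicator_of_mem hx', Set.indicator_of_mem hy', Set.indicator_of_mem hw']
        simp
      · rw [Set.indicator_of_notMem hy]
        simp only [mul_zero]
        exact mul_nonneg (mul_nonneg (Set.indicator_apply_nonneg fun _ => zero_le_one)
          (Set.indicator_apply_nonneg fun _ => zero_le_one))
          (Set.indicator_apply_nonneg fun _ => zero_le_one)
    · rw [Set.indicator_of_notMem hx]
      simp only [zero_mul]
      exact mul_nonneg (mul_nonneg (Set.indicator_apply_nonneg fun _ => zero_le_one)
        (Set.indicator_apply_nonneg fun _ => zero_le_one))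
        (Set.indicator_apply_nonneg fun _ => zero_le_one)
  · rw [if_neg hT]
    split_ifs
    · unfold KP iQH iL
      exact mul_nonneg (mul_nonneg (Set.indicator_apply_nonneg fun _ => zero_le_one)
        (Set.indicator_apply_nonneg fun _ => zero_le_one))
        (Set.indicator_apply_nonneg fun _ => zero_le_one)
    · exact le_rfl

omit [LinearOrder R] [IsStrictOrderedRing R] in
/-- A typed count as a sum over triples. -/
lemma typedCount_eq_sum (F : Finset E) (z : Config E) (τ : E → ℕ)
    (K : Config E → Config E → Config E → R) :
    typedCount F z τ K =
      ∑ t : Config E × Config E × Config E, if Typed F z τ t then K t.1 t.2.1 t.2.2 else 0 := by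
  unfold typedCount
  rw [Fintype.sum_prod_type]
  refine Finset.sum_congr rfl fun x _ => ?_
  rw [Fintype.sum_prod_type]

/-- **The typed switching inequality**: for every minor `(F, z)` and every type map `τ`,
`typedCount F z τ K_N ≤ typedCount F z τ K_P`. -/
theorem typedCount_N_le_P (ends : E → Sym2 V) (o a₁ a₂ v b : V) (F : Finset E) (z : Config E)
    (τ : E → ℕ) :
    typedCount F z τ (KN ends o a₁ a₂ v b : Config E → Config E → Config E → R) ≤
      typedCount F z τ (KP ends o a₁ a₂ v b) := by
  rw [typedCount_eq_sum, typedCount_eq_sum]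
  calc (∑ t : Config E × Config E × Config E,
          if Typed F z τ t then KN (R := R) ends o a₁ a₂ v b t.1 t.2.1 t.2.2 else 0)
      ≤ ∑ t : Config E × Config E × Config E,
          (if Typed F z τ (sw ends a₂ t) then
            KP (R := R) ends o a₁ a₂ v b (sw ends a₂ t).1 (sw ends a₂ t).2.1 (sw ends a₂ t).2.2
          else 0) :=
        Finset.sum_le_sum fun t _ => pointwise ends o a₁ a₂ v b F z τ t
    _ = ∑ t : Config E × Config E × Config E,
          (if Typed F z τ t then KP (R := R) ends o a₁ a₂ v b t.1 t.2.1 t.2.2 else 0) :=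
        Equiv.sum_comp (swPerm ends a₂)
          (fun t => if Typed F z τ t then KP (R := R) ends o a₁ a₂ v b t.1 t.2.1 t.2.2 else 0)

end Main

end ThreeCopySwitch

end Summit.Ventures.PercRepro2
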